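import Summits.CriticalPhenomena.PercolationContinuityZ3.Theorems.PercNearOneGluingNoHeavyLowerTailAPLBeadChain
import HarnessLib

/-!
# `NoHeavyLowerTail` (stmt-CriticalPhenomena-4575) — THE FAN THEOREM: `E ≤ 1` on every apex-over-path graph (corollary of the bead-chain theorem)

Support file (prover prim-ineq-gen-8 gen 58; `--supports stmt-CriticalPhenomena-4575`; memo
run/shared/lean/prim/prim-ineq-gen-8/FINDING-gen58-SERIES-LEAN.md §0(1); pencil version memo gen 57 FINDING-gen57-EROUTE.md §0(7)).
No definitions, no named facts, no sorries.

The fan `o ∗ P_{n+1}`: path vertices `x 0, …, x n` (pairwise distinct, `≠ o`), path edges `s(x k, x (k+1))` and apex edges `s(o, x k)` with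
ARBITRARY weights in `[0,1]` (weight `0` = absent, so every apex-over-path graph is covered); ports `u = x 0`, `v = x n`.  This is the bead chain
(`…APLBeadChain.lean`) with the singleton beads `S k = {s(o, x k)}`.  On it gen 55 found the `a*`-extremal family of the lineage and the law
`κ/m → n − (n−1)p`; the theorem says `κ² ≤ pπ·m` (`E ≤ 1`) nevertheless — stronger than Conjecture (★★₂) (`κ² ≤ 2pπm`) on this class.
* `fan_eq_beadChain` — the fan edge set is the bead-chain edge set with singleton beads.
* **`fan_E_le_one`** (`PrW` form), **`fan_E_le_one_prodBernoulli`** (`μ = prodBernoulli w`; every positive-weight pair is a fan edge).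
[this work]
-/

namespace Summit.CriticalPhenomena.PercolationContinuityZ3.Theorems

namespace APL

open Literature.Probability.Percolation Literature.Probability.Percolation.Gladkov Literature.Probability.Percolation.DecisionTree
open scoped Classical

variable {V : Type*} [Fintype V]

section Dec

variable [DecidableEq V] (o : V) (x : ℕ → V)

omit [Fintype V] in
/-- The fan edge set is the bead-chain edge set with singleton apex-edge beads. [folklore] -/
theorem fan_eq_beadChain (n : ℕ) :
    (Finset.range (n + 1)).image (fun k => s(o, x k)) ∪ (Finset.range n).image (fun k => s(x k, x (k + 1)))
      = (Finset.range (n + 1)).biUnion (fun k => ({s(o, x k)} : Finset (Sym2 V))) ∪ (Finset.range n).image (fun k => s(x k, x (k + 1))) := by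
  congr 1
  ext e
  simp only [Finset.mem_image, Finset.mem_biUnion, Finset.mem_singleton, eq_comm]

/-- **THE FAN THEOREM (`PrW` form)**: `(P(o↔u, o↔v) − P(o↔u)P(o↔v))² ≤ 1·P(o↔u)·P(o↔v)·P(o↮u, u↔v)` on the fan edge set, `u = x 0`, `v = x n`,
for all weights in `[0,1]`. [this work] -/
theorem fan_E_le_one (p : Sym2 V → ℝ) (hp0 : ∀ e, 0 ≤ p e) (hp1 : ∀ e, p e ≤ 1) (n : ℕ)
    (hx : ∀ i j, i ≤ n → j ≤ n → x i = x j → i = j) (hxo : ∀ i, i ≤ n → x i ≠ o) :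
    (PrW ((Finset.range (n + 1)).image (fun k => s(o, x k)) ∪ (Finset.range n).image (fun k => s(x k, x (k + 1)))) p
          {K : Finset (Sym2 V) | x 0 ∈ cl K o ∧ x n ∈ cl K o}
        - PrW ((Finset.range (n + 1)).image (fun k => s(o, x k)) ∪ (Finset.range n).image (fun k => s(x k, x (k + 1)))) p
            {K : Finset (Sym2 V) | x 0 ∈ cl K o}
          * PrW ((Finset.range (n + 1)).image (fun k => s(o, x k)) ∪ (Finset.range n).image (fun k => s(x k, x (k + 1)))) p
            {K : Finset (Sym2 V) | x n ∈ cl K o}) ^ 2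
      ≤ 1 * PrW ((Finset.range (n + 1)).image (fun k => s(o, x k)) ∪ (Finset.range n).image (fun k => s(x k, x (k + 1)))) p
            {K : Finset (Sym2 V) | x 0 ∈ cl K o}
        * PrW ((Finset.range (n + 1)).image (fun k => s(o, x k)) ∪ (Finset.range n).image (fun k => s(x k, x (k + 1)))) p
            {K : Finset (Sym2 V) | x n ∈ cl K o}
        * PrW ((Finset.range (n + 1)).image (fun k => s(o, x k)) ∪ (Finset.range n).image (fun k => s(x k, x (k + 1)))) p
            {K : Finset (Sym2 V) | x 0 ∉ cl K o ∧ x n ∈ cl K (x 0)} := by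
  rw [fan_eq_beadChain o x n]
  refine beadChain_E_le_one o x (fun k => ({s(o, x k)} : Finset (Sym2 V))) p hp0 hp1 n hx hxo ?_ ?_ ?_
  · -- distinct singleton beads are disjoint
    intro i j hi hj hij
    rw [Finset.disjoint_singleton_left, Finset.mem_singleton]
    intro h
    have h' : x i = x j := by
      rcases Sym2.eq_iff.1 h with ⟨_, h2⟩ | ⟨h1, _⟩
      · exact h2
      · exact absurd h1.symm (hxo j hj)
    exact hij (hx i j hi hj h')
  · -- two different apex edges share only `o`
    rintro i j hi hj hij z ⟨e, he, hze⟩ ⟨f, hf, hzf⟩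
    rw [Finset.mem_singleton] at he hf
    subst he; subst hf
    rcases Sym2.mem_iff.1 hze with h | h
    · exact h
    · rcases Sym2.mem_iff.1 hzf with h' | h'
      · exact h'
      · exact absurd (hx i j hi hj (h.symm.trans h')) hij
  · -- the path vertex `x j` meets only its own apex edge
    rintro i j hi hj ⟨e, he, hxe⟩
    rw [Finset.mem_singleton] at he
    subst he
    rcases Sym2.mem_iff.1 hxe with h | h
    · exact absurd h (hxo j hj)
    · exact (hx i j hi hj h.symm)

end Dec

/-- **THE FAN THEOREM for bond percolation** (`μ = prodBernoulli w` on the pairs of a finite vertex type; memo gen 57 §0(7), kernel gen 58).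
If every pair of positive weight is an edge of the fan `o ∗ (x 0 — x 1 — ⋯ — x n)` (apex edges `s(o, x k)`, path edges `s(x k, x (k+1))`,
arbitrary weights), `x 0, …, x n` pairwise distinct and `≠ o`, then with `u = x 0`, `v = x n`:
`(μ(o↔u ∩ o↔v) − μ(o↔u)·μ(o↔v))² ≤ μ(o↔u)·μ(o↔v)·μ((o↔u)ᶜ ∩ u↔v)` (`E ≤ 1`). [this work] -/
theorem fan_E_le_one_prodBernoulli (w : Sym2 V → unitInterval) (o : V) (x : ℕ → V) (n : ℕ)
    (hx : ∀ i j, i ≤ n → j ≤ n → x i = x j → i = j) (hxo : ∀ i, i ≤ n → x i ≠ o)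
    (hw : ∀ e : Sym2 V, 0 < (w e : ℝ) →
      e ∈ (Finset.range (n + 1)).image (fun k => s(o, x k)) ∪ (Finset.range n).image (fun k => s(x k, x (k + 1)))) :
    ((Literature.Probability.LatticeModels.prodBernoulli w).real
          ((openConn o (x 0) : Set (BondConfig V)) ∩ (openConn o (x n) : Set (BondConfig V)))
        - (Literature.Probability.LatticeModels.prodBernoulli w).real (openConn o (x 0) : Set (BondConfig V))
          * (Literature.Probability.LatticeModels.prodBernoulli w).real (openConn o (x n) : Set (BondConfig V))) ^ 2
      ≤ (Literature.Probability.LatticeModels.prodBernoulli w).real (openConn o (x 0) : Set (BondConfig V))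
        * (Literature.Probability.LatticeModels.prodBernoulli w).real (openConn o (x n) : Set (BondConfig V))
        * (Literature.Probability.LatticeModels.prodBernoulli w).real
          ((openConn o (x 0) : Set (BondConfig V))ᶜ ∩ (openConn (x 0) (x n) : Set (BondConfig V))) := by
  refine beadChain_E_le_one_prodBernoulli w o x (fun k => ({s(o, x k)} : Finset (Sym2 V))) n hx hxo ?_ ?_ ?_ ?_
  · intro i j hi hj hij
    rw [Finset.disjoint_singleton_left, Finset.mem_singleton]
    intro h
    have h' : x i = x j := by
      rcases Sym2.eq_iff.1 h with ⟨_, h2⟩ | ⟨h1, _⟩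
      · exact h2
      · exact absurd h1.symm (hxo j hj)
    exact hij (hx i j hi hj h')
  · rintro i j hi hj hij z ⟨e, he, hze⟩ ⟨f, hf, hzf⟩
    rw [Finset.mem_singleton] at he hf
    subst he; subst hf
    rcases Sym2.mem_iff.1 hze with h | h
    · exact h
    · rcases Sym2.mem_iff.1 hzf with h' | h'
      · exact h'
      · exact absurd (hx i j hi hj (h.symm.trans h')) hij
  · rintro i j hi hj ⟨e, he, hxe⟩
    rw [Finset.mem_singleton] at he
    subst he
    rcases Sym2.mem_iff.1 hxe with h | h
    · exact absurd h (hxo j hj)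
    · exact (hx i j hi hj h.symm)
  · intro e he
    rw [← fan_eq_beadChain o x n]
    exact hw e he

end APL

end Summit.CriticalPhenomena.PercolationContinuityZ3.Theorems
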